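import Summits.CriticalPhenomena.PercolationContinuityZ3.Theorems.SoloInformedCubeLemma
import Summits.CriticalPhenomena.PercolationContinuityZ3.Theorems.SoloInformedSlabBoxFace
import HarnessLib

/-!
# Sheet gluing: the extension step of Russo–Seymour–Welsh transfers to closed separating
sheets in every dimension (solo seat `solo-CriticalPhenomena-informed`, paper §7b.3 (d6))

Planar RSW theory has two halves: an EXTENSION step (long crossings from short ones — two long-way
crossings of overlapping rectangles and a short-way crossing of the overlap, glued by Harris–FKG
because the connector must meet both) and a SEED step (square ⇒ slightly elongated rectangle).  This
file certifies that the extension step holds verbatim for closed separating SHEETS of boxes in `ℤ^d`,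
`d` arbitrary, once the connector is taken to be a sheet as well; path–sheet duality does the work
that path–path intersection does in the plane.

Boxes.  Fix a "vertical" direction `k₀`, a "longitudinal" direction `k₁`, a height `t` and a width
`ℓ`; for integers `a ≤ b` let
`B[a,b] = {a ≤ x_{k₁} ≤ b} ∩ {0 ≤ x_{k₀} ≤ t} ∩ ⋂_{j ≠ k₀,k₁} {0 ≤ x_j ≤ ℓ}` (`xBox`),
`vertCrossing a b = {bottom {x_{k₀} = 0} ↔ top {x_{k₀} = t} inside B[a,b]}` and
`curtainCrossing a b = {{x_{k₁} = a} ↔ {x_{k₁} = b} inside B[a,b]}`.  The complement of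
`vertCrossing` is "a closed sheet of `B[a,b]` separates top from bottom"; the complement of
`curtainCrossing` is "a closed CURTAIN of `B[a,b]` separates its two `k₁`-faces".

* `vertCrossing_subset` — **gluing inclusion**: for `a₁ ≤ a₂ ≤ b₁ ≤ b₂`,
  `vertCrossing a₁ b₂ ⊆ vertCrossing a₁ b₁ ∪ vertCrossing a₂ b₂ ∪ curtainCrossing a₂ b₁`
  (an open bottom–top path of `B[a₁,b₂]` lying in neither `B[a₁,b₁]` nor `B[a₂,b₂]` visits
  `{x_{k₁} > b₁}` and `{x_{k₁} < a₂}`, and between two such visits it crosses the overlap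
  `B[a₂,b₁]` from face to face inside it: last index at level `≥ b₁` before the first index at level
  `≤ a₂`, `exists_faceToFace_window`).  Dually: sheets of `B[a₁,b₁]` and `B[a₂,b₂]` plus a curtain
  of the overlap make a sheet of `B[a₁,b₂]`.
* `real_sheet_gluing` — by Harris–FKG for the three decreasing events,
  `P(sheet in B[a₁,b₂]) ≥ P(sheet in B[a₁,b₁]) · P(sheet in B[a₂,b₂]) · P(curtain in B[a₂,b₁])`;
  with the translation invariance `real_vertCrossing_add` (`k₀ ≠ k₁`),
  `P(sheet in B[0,a+ℓ']) ≥ P(sheet in B[0,ℓ'])² · P(curtain in B[a,ℓ'])` for `0 ≤ a ≤ ℓ'`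
  (`real_sheet_gluing_sq`) — the exact analogue of the RSW rectangle-extension inequality.

Reading (paper §7b.3 (d6), "what transfers").  Iterating, a lower bound on hard-way sheet
probabilities at ONE aspect `< 1` along a sequence of scales propagates to sheets of every lateral
extent; so of planar RSW only the SEED fails to transfer to `d = 3` — which is where the cube face
(`SoloInformedCubeFace`) locates the missing engine.  Nothing here is specific to `p_c` or to `d = 3`.

References: L. Russo, Z. Wahrsch. verw. Geb. 43 (1978) 39–48; P. D. Seymour, D. J. A. Welsh, Ann.
Discrete Math. 3 (1978) 227–245; G. Grimmett, *Percolation*, 2nd ed., Springer 1999, §11.7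
(the RSW lemma) and Thm. (2.4) (Harris–FKG). [folklore]
-/

noncomputable section

namespace Summit.CriticalPhenomena.PercolationContinuityZ3.Theorems

open MeasureTheory ProbabilityTheory Filter Topology
open Literature.Probability.Percolation Literature.Probability.LatticeModels
open Literature.Probability.Percolation.CerfDembinVanishing
open scoped ENNReal

namespace SurfaceTension

variable {d : ℕ}

/-! ## Boxes with a variable longitudinal extent, and their crossings -/

/-- `B[a,b] = {a ≤ x_{k₁} ≤ b} ∩ {0 ≤ x_{k₀} ≤ t} ∩ ⋂_{j ≠ k₀, k₁} {0 ≤ x_j ≤ ℓ}`. -/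
def xBox (ℓ t : ℕ) (k₀ k₁ : Fin d) (a b : ℤ) : Set (Site d) :=
  {x | (a ≤ x k₁ ∧ x k₁ ≤ b) ∧ (0 ≤ x k₀ ∧ x k₀ ≤ t) ∧
    ∀ j, j ≠ k₀ → j ≠ k₁ → 0 ≤ x j ∧ x j ≤ ℓ}

/-- The bottom face `{x_{k₀} = 0}` of `B[a,b]`. -/
def xBot (ℓ t : ℕ) (k₀ k₁ : Fin d) (a b : ℤ) : Set (Site d) :=
  {x | x ∈ xBox ℓ t k₀ k₁ a b ∧ x k₀ = 0}

/-- The top face `{x_{k₀} = t}` of `B[a,b]`. -/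
def xTop (ℓ t : ℕ) (k₀ k₁ : Fin d) (a b : ℤ) : Set (Site d) :=
  {x | x ∈ xBox ℓ t k₀ k₁ a b ∧ x k₀ = t}

/-- The longitudinal face `{x_{k₁} = c}` of `B[a,b]` (`c = a` or `c = b`). -/
def xFace (ℓ t : ℕ) (k₀ k₁ : Fin d) (a b c : ℤ) : Set (Site d) :=
  {x | x ∈ xBox ℓ t k₀ k₁ a b ∧ x k₁ = c}

/-- `B[a,b]` is crossed from bottom to top by an open path inside it. -/
def vertCrossing (ℓ t : ℕ) (k₀ k₁ : Fin d) (a b : ℤ) : Set (BondConfig (Site d)) :=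
  linked (xBox ℓ t k₀ k₁ a b) (xBot ℓ t k₀ k₁ a b) (xTop ℓ t k₀ k₁ a b)

/-- `B[a,b]` is crossed longitudinally, from `{x_{k₁} = a}` to `{x_{k₁} = b}`, inside it. -/
def curtainCrossing (ℓ t : ℕ) (k₀ k₁ : Fin d) (a b : ℤ) : Set (BondConfig (Site d)) :=
  linked (xBox ℓ t k₀ k₁ a b) (xFace ℓ t k₀ k₁ a b a) (xFace ℓ t k₀ k₁ a b b)

/-- `vertCrossing` is increasing. -/
theorem isUpperSet_vertCrossing (ℓ t : ℕ) (k₀ k₁ : Fin d) (a b : ℤ) :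
    IsUpperSet (vertCrossing (d := d) ℓ t k₀ k₁ a b) :=
  isUpperSet_linked _ _ _

/-- `vertCrossing` is measurable. -/
theorem measurableSet_vertCrossing (ℓ t : ℕ) (k₀ k₁ : Fin d) (a b : ℤ) :
    MeasurableSet (vertCrossing (d := d) ℓ t k₀ k₁ a b) :=
  measurableSet_linked _ _ _

/-- `curtainCrossing` is increasing. -/
theorem isUpperSet_curtainCrossing (ℓ t : ℕ) (k₀ k₁ : Fin d) (a b : ℤ) :
    IsUpperSet (curtainCrossing (d := d) ℓ t k₀ k₁ a b) :=
  isUpperSet_linked _ _ _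

/-- `curtainCrossing` is measurable. -/
theorem measurableSet_curtainCrossing (ℓ t : ℕ) (k₀ k₁ : Fin d) (a b : ℤ) :
    MeasurableSet (curtainCrossing (d := d) ℓ t k₀ k₁ a b) :=
  measurableSet_linked _ _ _

/-! ## The walk-cutting lemma -/

/-- **Face-to-face window.** A lattice walk whose `k₁`-coordinate is `> b₁` at index `i₂` and
`< a₂` at a later index `i₁` (`a₂ ≤ b₁`) has an index window `[r, s]` on which the `k₁`-coordinate
stays in `[a₂, b₁]`, equal to `b₁` at `r` and to `a₂` at `s`; if all its vertices lie in `B`, the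
two window ends are joined inside `B ∩ {a₂ ≤ x_{k₁} ≤ b₁}`. -/
theorem exists_faceToFace_window {H : SimpleGraph (Site d)} (hH : H ≤ zdGraph d) {u v : Site d}
    (W : H.Walk u v) {B : Set (Site d)} (hB : ∀ i, W.getVert i ∈ B) (k₁ : Fin d) {a₂ b₁ : ℤ}
    (hab : a₂ ≤ b₁) {i₂ i₁ : ℕ} (hi : i₂ ≤ i₁) (hi₁ : i₁ ≤ W.length)
    (h₂ : b₁ < W.getVert i₂ k₁) (h₁ : W.getVert i₁ k₁ < a₂) :
    ∃ x y : Site d, (x ∈ B ∧ x k₁ = b₁) ∧ (y ∈ B ∧ y k₁ = a₂) ∧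
      (H ⊓ withinGraph (zdGraph d) {z | z ∈ B ∧ a₂ ≤ z k₁ ∧ z k₁ ≤ b₁}).Reachable x y := by
  classical
  -- one lattice step changes the coordinate by at most one
  have hstep : ∀ q, q < W.length →
      W.getVert q k₁ - W.getVert (q + 1) k₁ ≤ 1 ∧ W.getVert (q + 1) k₁ - W.getVert q k₁ ≤ 1 :=
    fun q hq => coord_sub_le_one_of_adj (hH (W.adj_getVert_succ hq)) k₁
  -- `s`: the first index `≥ i₂` at level `≤ a₂`
  have hex : ∃ s, i₂ ≤ s ∧ s ≤ i₁ ∧ W.getVert s k₁ ≤ a₂ := ⟨i₁, hi, le_rfl, h₁.le⟩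
  have hspec := Nat.find_spec hex
  have hmin' : ∀ q, q < Nat.find hex → ¬ (i₂ ≤ q ∧ q ≤ i₁ ∧ W.getVert q k₁ ≤ a₂) :=
    fun q hq => Nat.find_min hex hq
  set s := Nat.find hex with hsdef
  obtain ⟨hs₂, hs₁, hsa⟩ := hspec
  have hsmin : ∀ q, i₂ ≤ q → q < s → a₂ < W.getVert q k₁ := by
    intro q hq hqs
    have := hmin' q hqs
    push Not at this
    exact this hq (by omega)
  have hsi₂ : i₂ < s := by
    rcases Nat.lt_or_ge i₂ s with h | h
    · exact h
    · have : s = i₂ := le_antisymm h hs₂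
      rw [this] at hsa
      linarith
  have hseq : W.getVert s k₁ = a₂ := by
    have h1 := hsmin (s - 1) (by omega) (by omega)
    have h2 := (hstep (s - 1) (by omega)).1
    rw [show s - 1 + 1 = s by omega] at h2
    linarith
  -- `r`: the last index `≤ s` at level `≥ b₁`
  set r := Nat.findGreatest (fun q => b₁ ≤ W.getVert q k₁) s with hrdef
  have hrs : r ≤ s := Nat.findGreatest_le s
  have hri₂ : i₂ ≤ r := Nat.le_findGreatest hs₂ h₂.le
  have hrb : b₁ ≤ W.getVert r k₁ :=
    Nat.findGreatest_spec (P := fun q => b₁ ≤ W.getVert q k₁) hs₂ h₂.le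
  have hrmax : ∀ q, r < q → q ≤ s → W.getVert q k₁ < b₁ := by
    intro q hq hqs
    have := Nat.findGreatest_is_greatest (P := fun q => b₁ ≤ W.getVert q k₁) hq hqs
    push Not at this
    exact this
  have hreq : W.getVert r k₁ = b₁ := by
    rcases Nat.lt_or_ge r s with h | h
    · have h1 := hrmax (r + 1) (by omega) (by omega)
      have h2 := (hstep r (by omega)).1
      linarith
    · have : r = s := le_antisymm hrs h
      rw [this, hseq]
      rw [this, hseq] at hrb
      exact le_antisymm hab hrb
  -- the window `[r, s]`
  have hwin : ∀ q, r ≤ q → q ≤ r + (s - r) →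
      W.getVert q ∈ {z | z ∈ B ∧ a₂ ≤ z k₁ ∧ z k₁ ≤ b₁} := by
    intro q hq1 hq2
    refine ⟨hB q, ?_, ?_⟩
    · rcases Nat.lt_or_ge q s with h | h
      · exact (hsmin q (by omega) h).le
      · have : q = s := by omega
        rw [this, hseq]
    · rcases Nat.lt_or_ge r q with h | h
      · exact (hrmax q h (by omega)).le
      · have : q = r := by omega
        rw [this, hreq]
  have hreach := reachable_getVert_of_forall_mem hH W {z | z ∈ B ∧ a₂ ≤ z k₁ ∧ z k₁ ≤ b₁} r
    (s - r) (by omega) hwin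
  rw [show r + (s - r) = s by omega] at hreach
  exact ⟨W.getVert r, W.getVert s, ⟨hB r, hreq⟩, ⟨hB s, hseq⟩, hreach⟩

/-! ## The gluing inclusion -/

/-- **Sheet gluing (inclusion).** For `a₁ ≤ a₂ ≤ b₁ ≤ b₂`, an open bottom–top crossing of
`B[a₁,b₂]` inside it yields one of `B[a₁,b₁]`, one of `B[a₂,b₂]`, or an open face-to-face
longitudinal crossing of the overlap `B[a₂,b₁]`.  Equivalently: closed sheets separating top from
bottom in `B[a₁,b₁]` and in `B[a₂,b₂]` together with a closed curtain separating the two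
`k₁`-faces of `B[a₂,b₁]` separate top from bottom in `B[a₁,b₂]`. -/
theorem vertCrossing_subset (ℓ t : ℕ) (k₀ k₁ : Fin d) {a₁ a₂ b₁ b₂ : ℤ} (h₁ : a₁ ≤ a₂)
    (h₂ : a₂ ≤ b₁) (h₃ : b₁ ≤ b₂) :
    vertCrossing ℓ t k₀ k₁ a₁ b₂ ⊆ vertCrossing ℓ t k₀ k₁ a₁ b₁ ∪ vertCrossing ℓ t k₀ k₁ a₂ b₂ ∪
      curtainCrossing ℓ t k₀ k₁ a₂ b₁ := by
  classical
  intro ω hω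
  rw [vertCrossing, mem_linked_iff] at hω
  obtain ⟨u, hu, v, hv, huv⟩ := hω
  rw [mem_inConn_iff] at huv
  obtain ⟨W⟩ := huv
  set B := xBox ℓ t k₀ k₁ a₁ b₂ with hBdef
  set H := openGraph ω ⊓ withinGraph (zdGraph d) B with hHdef
  have hHB : H ≤ withinGraph (zdGraph d) B := inf_le_right
  have hHG : H ≤ zdGraph d := hHB.trans (withinGraph_le _ _)
  have hall : ∀ i, W.getVert i ∈ B := getVert_mem_of_le_withinGraph hHB W hu.1
  -- the restriction of `H` to a sub-box `C ⊆` (as a set of sites) is an open graph inside `C`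
  have hmono : ∀ C : Set (Site d),
      H ⊓ withinGraph (zdGraph d) C ≤ openGraph ω ⊓ withinGraph (zdGraph d) C := by
    intro C z w hzw
    rw [SimpleGraph.inf_adj, withinGraph_adj] at hzw ⊢
    rw [hHdef, SimpleGraph.inf_adj] at hzw
    exact ⟨hzw.1.1, hzw.2⟩
  by_cases hle : ∀ i, i ≤ W.length → W.getVert i k₁ ≤ b₁
  · -- the path stays in `B[a₁,b₁]`
    have hC : ∀ q, 0 ≤ q → q ≤ 0 + W.length → W.getVert q ∈ xBox ℓ t k₀ k₁ a₁ b₁ := by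
      intro q _ hq
      have hq' := hall q
      exact ⟨⟨hq'.1.1, hle q (by omega)⟩, hq'.2.1, hq'.2.2⟩
    have hr := reachable_getVert_of_forall_mem hHG W (xBox ℓ t k₀ k₁ a₁ b₁) 0 W.length
      (by omega) hC
    rw [zero_add, SimpleGraph.Walk.getVert_zero, SimpleGraph.Walk.getVert_length] at hr
    refine Or.inl (Or.inl (mem_linked_iff.2 ⟨u, ⟨?_, hu.2⟩, v, ⟨?_, hv.2⟩,
      mem_inConn_iff.2 (hr.mono (hmono _))⟩))
    · simpa using hC 0 le_rfl (by omega)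
    · simpa using hC W.length (by omega) (by omega)
  push Not at hle
  obtain ⟨i₂, hi₂, hb⟩ := hle
  by_cases hge : ∀ i, i ≤ W.length → a₂ ≤ W.getVert i k₁
  · -- the path stays in `B[a₂,b₂]`
    have hC : ∀ q, 0 ≤ q → q ≤ 0 + W.length → W.getVert q ∈ xBox ℓ t k₀ k₁ a₂ b₂ := by
      intro q _ hq
      have hq' := hall q
      exact ⟨⟨hge q (by omega), hq'.1.2⟩, hq'.2.1, hq'.2.2⟩
    have hr := reachable_getVert_of_forall_mem hHG W (xBox ℓ t k₀ k₁ a₂ b₂) 0 W.length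
      (by omega) hC
    rw [zero_add, SimpleGraph.Walk.getVert_zero, SimpleGraph.Walk.getVert_length] at hr
    refine Or.inl (Or.inr (mem_linked_iff.2 ⟨u, ⟨?_, hu.2⟩, v, ⟨?_, hv.2⟩,
      mem_inConn_iff.2 (hr.mono (hmono _))⟩))
    · simpa using hC 0 le_rfl (by omega)
    · simpa using hC W.length (by omega) (by omega)
  push Not at hge
  obtain ⟨i₁, hi₁, ha⟩ := hge
  -- the path visits `{x_{k₁} > b₁}` and `{x_{k₁} < a₂}`: it crosses the overlap face to face
  have hO : {z | z ∈ B ∧ a₂ ≤ z k₁ ∧ z k₁ ≤ b₁} = xBox ℓ t k₀ k₁ a₂ b₁ := by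
    ext z
    simp only [Set.mem_setOf_eq, hBdef, xBox]
    constructor
    · rintro ⟨⟨-, h0, hj⟩, hz1, hz2⟩
      exact ⟨⟨hz1, hz2⟩, h0, hj⟩
    · rintro ⟨⟨hz1, hz2⟩, h0, hj⟩
      exact ⟨⟨⟨by linarith, by linarith⟩, h0, hj⟩, hz1, hz2⟩
  have finish : ∀ x y : Site d, (x ∈ B ∧ x k₁ = b₁) → (y ∈ B ∧ y k₁ = a₂) →
      (H ⊓ withinGraph (zdGraph d) {z | z ∈ B ∧ a₂ ≤ z k₁ ∧ z k₁ ≤ b₁}).Reachable x y →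
      ω ∈ curtainCrossing ℓ t k₀ k₁ a₂ b₁ := by
    intro x y hx hy hr
    rw [hO] at hr
    have hxO : x ∈ xBox ℓ t k₀ k₁ a₂ b₁ := by
      rw [← hO]; exact ⟨hx.1, by linarith [hx.2], hx.2.le⟩
    have hyO : y ∈ xBox ℓ t k₀ k₁ a₂ b₁ := by
      rw [← hO]; exact ⟨hy.1, hy.2.ge, by linarith [hy.2]⟩
    exact mem_linked_iff.2 ⟨y, ⟨hyO, hy.2⟩, x, ⟨hxO, hx.2⟩,
      mem_inConn_iff.2 (hr.mono (hmono _)).symm⟩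
  rcases le_total i₂ i₁ with hii | hii
  · obtain ⟨x, y, hx, hy, hr⟩ :=
      exists_faceToFace_window hHG W hall k₁ h₂ hii hi₁ hb ha
    exact Or.inr (finish x y hx hy hr)
  · have hall' : ∀ i, W.reverse.getVert i ∈ B := fun i => by
      rw [SimpleGraph.Walk.getVert_reverse]; exact hall _
    obtain ⟨x, y, hx, hy, hr⟩ :=
      exists_faceToFace_window hHG W.reverse hall' k₁ h₂ (i₂ := W.length - i₂)
        (i₁ := W.length - i₁) (by omega) (by rw [SimpleGraph.Walk.length_reverse]; omega)
        (by rw [SimpleGraph.Walk.getVert_reverse, show W.length - (W.length - i₂) = i₂ by omega];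
            exact hb)
        (by rw [SimpleGraph.Walk.getVert_reverse, show W.length - (W.length - i₁) = i₁ by omega];
            exact ha)
    exact Or.inr (finish x y hx hy hr)

/-! ## Harris–FKG: the gluing inequality -/

/-- **Sheet gluing (probabilities).** For `a₁ ≤ a₂ ≤ b₁ ≤ b₂` and every `p`:
`P(no vertical crossing of B[a₁,b₁]) · P(none of B[a₂,b₂]) · P(no curtain crossing of B[a₂,b₁])
≤ P(no vertical crossing of B[a₁,b₂])`. -/
theorem real_sheet_gluing (p : unitInterval) (ℓ t : ℕ) (k₀ k₁ : Fin d) {a₁ a₂ b₁ b₂ : ℤ}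
    (h₁ : a₁ ≤ a₂) (h₂ : a₂ ≤ b₁) (h₃ : b₁ ≤ b₂) :
    (bondPercolation (zdGraph d) p).real (vertCrossing ℓ t k₀ k₁ a₁ b₁)ᶜ *
        (bondPercolation (zdGraph d) p).real (vertCrossing ℓ t k₀ k₁ a₂ b₂)ᶜ *
        (bondPercolation (zdGraph d) p).real (curtainCrossing ℓ t k₀ k₁ a₂ b₁)ᶜ ≤
      (bondPercolation (zdGraph d) p).real (vertCrossing ℓ t k₀ k₁ a₁ b₂)ᶜ := by
  set μ := bondPercolation (zdGraph d) p with hμ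
  have hA := (isUpperSet_vertCrossing (d := d) ℓ t k₀ k₁ a₁ b₁).compl
  have hB := (isUpperSet_vertCrossing (d := d) ℓ t k₀ k₁ a₂ b₂).compl
  have hC := (isUpperSet_curtainCrossing (d := d) ℓ t k₀ k₁ a₂ b₁).compl
  have hAm := (measurableSet_vertCrossing (d := d) ℓ t k₀ k₁ a₁ b₁).compl
  have hBm := (measurableSet_vertCrossing (d := d) ℓ t k₀ k₁ a₂ b₂).compl
  have hCm := (measurableSet_curtainCrossing (d := d) ℓ t k₀ k₁ a₂ b₁).compl
  have h12 := harris_fkg_lower (zdGraph d) p hA hB hAm hBm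
  have h123 := harris_fkg_lower (zdGraph d) p (hA.inter hB) hC (hAm.inter hBm) hCm
  have hsub : (vertCrossing ℓ t k₀ k₁ a₁ b₁)ᶜ ∩ (vertCrossing ℓ t k₀ k₁ a₂ b₂)ᶜ ∩
      (curtainCrossing ℓ t k₀ k₁ a₂ b₁)ᶜ ⊆ (vertCrossing (d := d) ℓ t k₀ k₁ a₁ b₂)ᶜ := by
    rintro ω ⟨⟨hω₁, hω₂⟩, hω₃⟩ hω
    rcases vertCrossing_subset ℓ t k₀ k₁ h₁ h₂ h₃ hω with (h | h) | h
    · exact hω₁ h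
    · exact hω₂ h
    · exact hω₃ h
  have hCnn : 0 ≤ μ.real (curtainCrossing ℓ t k₀ k₁ a₂ b₁)ᶜ := measureReal_nonneg
  calc μ.real (vertCrossing ℓ t k₀ k₁ a₁ b₁)ᶜ * μ.real (vertCrossing ℓ t k₀ k₁ a₂ b₂)ᶜ *
        μ.real (curtainCrossing ℓ t k₀ k₁ a₂ b₁)ᶜ
      ≤ μ.real ((vertCrossing ℓ t k₀ k₁ a₁ b₁)ᶜ ∩ (vertCrossing ℓ t k₀ k₁ a₂ b₂)ᶜ) *
        μ.real (curtainCrossing ℓ t k₀ k₁ a₂ b₁)ᶜ := mul_le_mul_of_nonneg_right h12 hCnn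
    _ ≤ μ.real ((vertCrossing ℓ t k₀ k₁ a₁ b₁)ᶜ ∩ (vertCrossing ℓ t k₀ k₁ a₂ b₂)ᶜ ∩
        (curtainCrossing ℓ t k₀ k₁ a₂ b₁)ᶜ) := h123
    _ ≤ μ.real (vertCrossing ℓ t k₀ k₁ a₁ b₂)ᶜ := measureReal_mono hsub

/-! ## Translation invariance along `k₁` -/

/-- Translating a box along `k₁` does not change its vertical-crossing probability (`k₀ ≠ k₁`). -/
theorem real_vertCrossing_add (p : unitInterval) (ℓ t : ℕ) {k₀ k₁ : Fin d} (hk : k₀ ≠ k₁)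
    (a b c : ℤ) :
    (bondPercolation (zdGraph d) p).real (vertCrossing ℓ t k₀ k₁ (a + c) (b + c)) =
      (bondPercolation (zdGraph d) p).real (vertCrossing ℓ t k₀ k₁ a b) := by
  set w : Site d := Pi.single k₁ c with hw
  set φ : zdGraph d ≃g zdGraph d := zdShiftIso w with hφ
  have key₁ : ∀ x : Site d, (φ x) k₁ = x k₁ + c := fun x => by simp [hφ, hw]
  have key₀ : ∀ x : Site d, ∀ j, j ≠ k₁ → (φ x) j = x j := fun x j hj => by
    simp [hφ, hw, Pi.single_eq_of_ne hj]
  have hS : ∀ x : Site d, x ∈ xBox ℓ t k₀ k₁ a b ↔ φ x ∈ xBox ℓ t k₀ k₁ (a + c) (b + c) := by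
    intro x
    simp only [xBox, Set.mem_setOf_eq, key₁, key₀ x k₀ hk]
    refine ⟨fun h => ⟨⟨by linarith [h.1.1], by linarith [h.1.2]⟩, h.2.1, fun j hj0 hj1 => ?_⟩,
      fun h => ⟨⟨by linarith [h.1.1], by linarith [h.1.2]⟩, h.2.1, fun j hj0 hj1 => ?_⟩⟩
    · rw [key₀ x j hj1]; exact h.2.2 j hj0 hj1
    · have := h.2.2 j hj0 hj1; rwa [key₀ x j hj1] at this
  have hSim : (φ.toEquiv : Site d ≃ Site d) '' xBox ℓ t k₀ k₁ a b =
      xBox ℓ t k₀ k₁ (a + c) (b + c) := image_eq_of_forall_iff φ.toEquiv hS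
  have hBim : (φ.toEquiv : Site d ≃ Site d) '' xBot ℓ t k₀ k₁ a b =
      xBot ℓ t k₀ k₁ (a + c) (b + c) :=
    image_eq_of_forall_iff φ.toEquiv fun x => by
      simp only [xBot, Set.mem_setOf_eq, hS]
      exact and_congr_right fun _ => by
        rw [show ((φ.toEquiv : Site d ≃ Site d) x) k₀ = (φ x) k₀ from rfl, key₀ x k₀ hk]
  have hTim : (φ.toEquiv : Site d ≃ Site d) '' xTop ℓ t k₀ k₁ a b =
      xTop ℓ t k₀ k₁ (a + c) (b + c) :=
    image_eq_of_forall_iff φ.toEquiv fun x => by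
      simp only [xTop, Set.mem_setOf_eq, hS]
      exact and_congr_right fun _ => by
        rw [show ((φ.toEquiv : Site d ≃ Site d) x) k₀ = (φ x) k₀ from rfl, key₀ x k₀ hk]
  have himg := real_linked_image φ p (xBox ℓ t k₀ k₁ a b) (xBot ℓ t k₀ k₁ a b)
    (xTop ℓ t k₀ k₁ a b)
  rw [vertCrossing, vertCrossing, ← himg]
  change _ = (bondPercolation (zdGraph d) p).real
      (linked ((φ.toEquiv : Site d ≃ Site d) '' xBox ℓ t k₀ k₁ a b)
        ((φ.toEquiv : Site d ≃ Site d) '' xBot ℓ t k₀ k₁ a b)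
        ((φ.toEquiv : Site d ≃ Site d) '' xTop ℓ t k₀ k₁ a b))
  rw [hSim, hBim, hTim]

/-- **The RSW extension inequality for sheets.** For `k₀ ≠ k₁`, `0 ≤ a ≤ ℓ'` and every `p`:
`P(no vertical crossing of B[0,ℓ'])² · P(no curtain crossing of B[a,ℓ'])
≤ P(no vertical crossing of B[0, a + ℓ'])` — two sheets of boxes of longitudinal extent `ℓ'`
overlapping in `B[a,ℓ']`, glued by a curtain of the overlap, give a sheet of extent `a + ℓ'`. -/
theorem real_sheet_gluing_sq (p : unitInterval) (ℓ t : ℕ) {k₀ k₁ : Fin d} (hk : k₀ ≠ k₁)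
    {a ℓ' : ℤ} (ha : 0 ≤ a) (haℓ : a ≤ ℓ') :
    (bondPercolation (zdGraph d) p).real (vertCrossing ℓ t k₀ k₁ 0 ℓ')ᶜ ^ 2 *
        (bondPercolation (zdGraph d) p).real (curtainCrossing ℓ t k₀ k₁ a ℓ')ᶜ ≤
      (bondPercolation (zdGraph d) p).real (vertCrossing ℓ t k₀ k₁ 0 (a + ℓ'))ᶜ := by
  have h := real_sheet_gluing p ℓ t k₀ k₁ (a₁ := 0) (a₂ := a) (b₁ := ℓ') (b₂ := a + ℓ') ha haℓ
    (by linarith)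
  have htr : (bondPercolation (zdGraph d) p).real (vertCrossing ℓ t k₀ k₁ a (a + ℓ'))ᶜ =
      (bondPercolation (zdGraph d) p).real (vertCrossing ℓ t k₀ k₁ 0 ℓ')ᶜ := by
    rw [probReal_compl_eq_one_sub (measurableSet_vertCrossing _ _ _ _ _ _),
      probReal_compl_eq_one_sub (measurableSet_vertCrossing _ _ _ _ _ _),
      show (a : ℤ) = 0 + a by ring, show (0 : ℤ) + a + ℓ' = ℓ' + a by ring,
      real_vertCrossing_add p ℓ t hk 0 ℓ' a]
  rw [htr] at h
  simpa [sq, mul_assoc] using h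

end SurfaceTension

end Summit.CriticalPhenomena.PercolationContinuityZ3.Theorems
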